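import Summits.ResolutionOfSingularities.ResolutionOfSingularities.Theses.UniversalCells
import Summits.ResolutionOfSingularities.ResolutionOfSingularities.Theorems.UniversalCellsDefs

/-!
# Sketch — crux-strategist pass on `UniversalCells.Universality` (stmt-ResolutionOfSingularities-15234)

Signatures only (`sorry`-stubbed), elaborated on the farm, for the STRATEGY-CENSUS and the crux idea
`staudt-induction`:

* `addGadgetExtension` — FIRST LEMMA of idea `staudt-induction` (lens: strengthen): the von Staudt
  ADDITION gadget as a CONFIGURATION-EXTENSION lemma on normalised partial stratum rings — adjoining the
  three gadget columns `Qa = (x_j : 0 : 1)`, `H = (x_i + x_j : 1 : 1)`, `Vs = (x_i + x_j : 1 : 0)` with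
  their six imposed minors to ANY configuration containing the constant column `X = (0 : -1 : 1)` and
  two value columns `V_i = (x_i : 1 : 0)`, `V_j` does not change the ring, and the new value column
  represents `x_i + x_j`. (Multiplication / quotient / free-column gadgets have the same shape.)
* `unitSectionGlobalisation` — the specialised chart globalisation (census §Decomposition nudge): with
  the encoding's output `g = ∏ t`, `h = 1`, the point over `y` is the UNIT SECTION `t = 1`, no prime
  ideal is pushed anywhere.
* `UniformStratumChart` — the strengthening `S⁺` of the census (§Strengthen): ONE chart per finite
  presentation, over ANY commutative base ring, the partial stratum being the split torus over
  `Spec` of the presented algebra.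
-/

noncomputable section

set_option linter.dupNamespace false

open CategoryTheory AlgebraicGeometry
open Summit.ResolutionOfSingularities.ResolutionOfSingularities.Theorems.UniversalCells
open Summit.ResolutionOfSingularities.ResolutionOfSingularities.Theses.UniversalCells (Universality)

namespace Summit.ResolutionOfSingularities.ResolutionOfSingularities.Cruxes.Universality.StaudtInduction

/-! ## Configuration extension by `k` new columns -/

/-- Push a column selector along the inclusion of column indices `κ ↪ κ ⊕ Fin k`. [folklore] -/
abbrev pushSel {κ : Type} (k : ℕ) (u : Fin 3 → Fin 3 ⊕ (Unit ⊕ κ)) :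
    Fin 3 → Fin 3 ⊕ (Unit ⊕ (κ ⊕ Fin k)) :=
  Sum.map id (Sum.map id Sum.inl) ∘ u

/-- An old column, seen in the extended matrix `[I₃ | F | old | new]`. -/
abbrev oldCol {κ : Type} (k : ℕ) (c : κ) : Fin 3 ⊕ (Unit ⊕ (κ ⊕ Fin k)) :=
  Sum.inr (Sum.inr (Sum.inl c))
/-- A new column. -/
abbrev newCol {κ : Type} (k : ℕ) (t : Fin k) : Fin 3 ⊕ (Unit ⊕ (κ ⊕ Fin k)) :=
  Sum.inr (Sum.inr (Sum.inr t))
/-- An identity column `e_i`. -/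
abbrev idCol {κ : Type} (k : ℕ) (i : Fin 3) : Fin 3 ⊕ (Unit ⊕ (κ ⊕ Fin k)) := Sum.inl i
/-- The frame column `F = (1 : 1 : 1)`. -/
abbrev frameCol {κ : Type} (k : ℕ) : Fin 3 ⊕ (Unit ⊕ (κ ⊕ Fin k)) := Sum.inr (Sum.inl ())

/-- The six imposed minors of the ADDITION gadget on the new columns `0 ↦ Qa`, `1 ↦ H`, `2 ↦ Vs`
(designated rows `2, 1, 1`): `(Qa)_1 = 0`, `det(X, V_j, Qa) = 0`, `det(e_0, F, H) = 0`,
`det(V_i, Qa, H) = 0`, `(Vs)_2 = 0`, `det(e_2, Vs, H) = 0` — verbatim the addition rows of the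
line's `config`, with the read-off incidence moved to a fresh value column. [cite: LeeVakil2012, §3] -/
abbrev addSels {κ : Type} (cX ci cj : κ) : Set (Fin 3 → Fin 3 ⊕ (Unit ⊕ (κ ⊕ Fin 3))) :=
  ({ entrySel (Unit ⊕ (κ ⊕ Fin 3)) 1 (Sum.inr (Sum.inr 0)),
     ![oldCol 3 cX, oldCol 3 cj, newCol 3 0],
     ![idCol 3 0, frameCol 3, newCol 3 1],
     ![oldCol 3 ci, newCol 3 0, newCol 3 1],
     entrySel (Unit ⊕ (κ ⊕ Fin 3)) 2 (Sum.inr (Sum.inr 2)),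
     ![idCol 3 2, newCol 3 2, newCol 3 1] } : Set (Fin 3 → Fin 3 ⊕ (Unit ⊕ (κ ⊕ Fin 3))))

/-- The class of a matrix variable in a normalised stratum ring (notation helper). -/
abbrev nv (p : ℕ) (κ : Type) (d : κ → Fin 3) (Γ0 : Set (Fin 3 → Fin 3 ⊕ (Unit ⊕ κ)))
    (i : Fin 3) (c : κ) : NormRing p κ d Γ0 :=
  Ideal.Quotient.mk (normIdeal p κ d Γ0) (MvPolynomial.X (i, c))

/-- **FIRST LEMMA of idea `staudt-induction` (addition gadget as configuration extension).**
Let `(κ, d, Γ₀)` be any configuration whose normalised stratum ring contains the constant column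
`X = (0 : -1 : 1)` at index `cX` and value columns `(x : 1 : 0)` at indices `ci`, `cj` (five
equations). Extend by the three addition-gadget columns with designated rows `(2, 1, 1)` and the six
selectors `addSels`. Then the extended normalised stratum ring is isomorphic to the old one
compatibly with the old variables, and the new value column `Vs` is `(x_i + x_j : 1 : 0)`.
Proof sketch: the six new minors are, modulo the five equations and in the order listed, `±` a fresh
entry of a new column plus a polynomial in earlier entries (pivots `±1`, no genericity, every
characteristic — machine-checked over `ℤ`, kit job j024140); so the canonical map old → new is
surjective, and the substitution of solved values is a well-defined retraction. [cite: LeeVakil2012,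
§2 "Reduction to four problems" (addition problem), §3; Mnev1988] -/
theorem addGadgetExtension (p : ℕ) (κ : Type) [Fintype κ] [DecidableEq κ] (d : κ → Fin 3)
    (Γ0 : Set (Fin 3 → Fin 3 ⊕ (Unit ⊕ κ))) (cX ci cj : κ)
    (hX0 : nv p κ d Γ0 0 cX = 0) (hX1 : nv p κ d Γ0 1 cX = -1) (hX2 : nv p κ d Γ0 2 cX = 1)
    (hi1 : nv p κ d Γ0 1 ci = 1) (hi2 : nv p κ d Γ0 2 ci = 0)
    (hj1 : nv p κ d Γ0 1 cj = 1) (hj2 : nv p κ d Γ0 2 cj = 0) :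
    ∃ e : NormRing p (κ ⊕ Fin 3) (Sum.elim d ![2, 1, 1]) (pushSel 3 '' Γ0 ∪ addSels cX ci cj) ≃+*
        NormRing p κ d Γ0,
      (∀ (i : Fin 3) (c : κ),
          e (nv p (κ ⊕ Fin 3) (Sum.elim d ![2, 1, 1]) (pushSel 3 '' Γ0 ∪ addSels cX ci cj) i
            (Sum.inl c)) = nv p κ d Γ0 i c) ∧
      e (nv p (κ ⊕ Fin 3) (Sum.elim d ![2, 1, 1]) (pushSel 3 '' Γ0 ∪ addSels cX ci cj) 0
          (Sum.inr 2)) = nv p κ d Γ0 0 ci + nv p κ d Γ0 0 cj ∧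
      e (nv p (κ ⊕ Fin 3) (Sum.elim d ![2, 1, 1]) (pushSel 3 '' Γ0 ∪ addSels cX ci cj) 1
          (Sum.inr 2)) = 1 ∧
      e (nv p (κ ⊕ Fin 3) (Sum.elim d ![2, 1, 1]) (pushSel 3 '' Γ0 ∪ addSels cX ci cj) 2
          (Sum.inr 2)) = 0 := by
  sorry

/-- The target of the induction of idea `staudt-induction` (it replaces the pair `stub_flattening` +
`stub_normalizedEncoding` of line `birth`): every finite presentation over `𝔽_p` is a normalised
partial stratum ring, for SOME configuration (found by structural induction on the presentation,
one gadget at a time). [cite: LeeVakil2012, §2] -/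
def PresentedIsNorm : Prop :=
  ∀ (p n : ℕ) (S : Finset (MvPolynomial (Fin n) (ZMod p))),
    ∃ (κ : Type) (_ : Fintype κ) (_ : DecidableEq κ) (d : κ → Fin 3)
      (Γ0 : Set (Fin 3 → Fin 3 ⊕ (Unit ⊕ κ))),
      Nonempty (NormRing p κ d Γ0 ≃+*
        MvPolynomial (Fin n) (ZMod p) ⧸ Ideal.span (↑S : Set (MvPolynomial (Fin n) (ZMod p))))

/-! ## The specialised globalisation (census nudge) -/

/-- **Unit-section globalisation.** With the encoding's actual output (`g = ∏ t`, `h = 1`: the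
partial stratum IS the split torus over the chart), the crux's conclusion at `y ∈ U` follows with
`W := Spec B[t^{±1}]`, `i` an isomorphism onto `Spec S`, `j` = localisation ≫ `𝔸ˢ`-transport of
`U ≅ Spec B` ≫ `AffineSpace.map U.ι`, and the point `w :=` the unit section `t = 1` over the point of
`Spec B` corresponding to `y` — no prime ideal is extended or contracted. [cite: StacksProject, Tag
01JJ; LeeVakil2012, §2 Strategy (b)] -/
theorem unitSectionGlobalisation (p : ℕ) (Y : Scheme.{0}) (hY : IsIntegral Y) (y : Y)
    (U : Y.Opens) (hU : IsAffineOpen U) (hy : y ∈ U) (B : Type) [CommRing B]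
    (e : Γ(Y, U) ≃+* B) (m : ℕ) (Γp : Finset (Fin 3 → Fin 3 ⊕ Fin m))
    (Γ0 : Set (Fin 3 → Fin 3 ⊕ Fin m)) (s : ℕ)
    (echart : TorusRing (Fin s) B ≃+* StratumRing p m Γp Γ0) :
    ∃ (W : Scheme.{0}) (j : W ⟶ 𝔸(Fin s; Y)) (w : W)
      (i : W ⟶ Spec (.of (StratumRing p m Γp Γ0))),
      IsOpenImmersion j ∧ IsOpenImmersion i ∧ IsIntegral W ∧ (𝔸(Fin s; Y) ↘ Y).base (j.base w) = y := by
  sorry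

/-! ## The strengthening `S⁺` (census §Strengthen): one chart per presentation, any base ring -/

/-- `[I₃ | A]` over an arbitrary commutative base ring. [folklore] -/
abbrev tautMatrixR (R : Type) [CommRing R] (m : ℕ) :
    Matrix (Fin 3) (Fin 3 ⊕ Fin m) (MvPolynomial (Fin 3 × Fin m) R) :=
  Matrix.fromCols 1 (Matrix.of fun i j => MvPolynomial.X (i, j))

/-- The partial stratum ring `S_R(m, Γ₊, Γ₀)` over an arbitrary commutative base ring (at
`R = ZMod p` this is the crux's ring verbatim). [folklore] -/
abbrev StratumRingR (R : Type) [CommRing R] (m : ℕ) (Γp : Finset (Fin 3 → Fin 3 ⊕ Fin m))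
    (Γ0 : Set (Fin 3 → Fin 3 ⊕ Fin m)) : Type :=
  Localization.Away (Ideal.Quotient.mk
    (Ideal.span ((fun u : Fin 3 → Fin 3 ⊕ Fin m => ((tautMatrixR R m).submatrix id u).det) '' Γ0))
    (∏ u ∈ Γp, ((tautMatrixR R m).submatrix id u).det))

/-- **`S⁺` — UNIFORM, BASE-FREE STRATUM CHART.** For every commutative ring `R` and every finite
presentation `B = R[x_1..x_n] ⧸ ⟨S⟩` there are `m, Γ₊, Γ₀, s` with `S_R(m, Γ₊, Γ₀) ≃+* B[t_1^{±1}, …,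
t_s^{±1}]`: the partial stratum is the split `s`-torus over `Spec B`, so ONE chart serves every point
of `Spec B` at once and nothing depends on the characteristic. This is what line `birth` actually
proves at `R = ZMod p` (its `g = ∏ t`, `h = 1`); the crux is the case `R = ZMod p` followed by chart
globalisation. [cite: Lafforgue2003, Thm. I.14; LeeVakil2012, Thm. 1.1] -/
def UniformStratumChart : Prop :=
  ∀ (R : Type) [CommRing R] (n : ℕ) (S : Finset (MvPolynomial (Fin n) R)),
    ∃ (m : ℕ) (Γp : Finset (Fin 3 → Fin 3 ⊕ Fin m)) (Γ0 : Set (Fin 3 → Fin 3 ⊕ Fin m)) (s : ℕ),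
      Nonempty (StratumRingR R m Γp Γ0 ≃+*
        TorusRing (Fin s) (MvPolynomial (Fin n) R ⧸ Ideal.span (↑S : Set (MvPolynomial (Fin n) R))))

/-- Sanity: at `R = ZMod p` the base-free stratum ring is the crux's stratum ring, definitionally. -/
example (p m : ℕ) (Γp : Finset (Fin 3 → Fin 3 ⊕ Fin m)) (Γ0 : Set (Fin 3 → Fin 3 ⊕ Fin m)) :
    StratumRingR (ZMod p) m Γp Γ0 = StratumRing p m Γp Γ0 := rfl

end Summit.ResolutionOfSingularities.ResolutionOfSingularities.Cruxes.Universality.StaudtInduction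

end
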